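import Summits.CriticalPhenomena.PercolationContinuityZ3.Theorems.PercNearOneGluingNoHeavyLowerTailIncStarMarkPairSteps
import Summits.CriticalPhenomena.PercolationContinuityZ3.Theorems.PercNearOneGluingNoHeavyLowerTailIncStarRootEdgeInduction
import HarnessLib

/-!
# The increasing star from Bernstein positivity along TARGET–UNMARKED pairs alone (the target-edge induction schema)

Support file for the Sahi programme (`--supports stmt-CriticalPhenomena-4575`, prover prim-sahi-p2 gen 13).  No definitions, no named
facts, no sorries; standard axioms.  Memo `…/prim-sahi-p2/PROOF-E3.md` §24e, `FROM-prim-sahi-p2-gen13-INDEPENDENT-MARKS.md` §3.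

Gen 4's root-edge schema (`IncStar.incStar_nonneg_of_rootUnmarkedBernsteinStrongIH`) reduces the increasing star `0 ≤ E₃({s↔b},{s↔c},{s↔y})`
to Bernstein positivity along ROOT–UNMARKED pairs (hRZ).  With the root–target step (gen 4) AND the target–target step (gen 13) both proved, the
induction can instead be run through the pairs AT THE TARGETS:

**Theorem `incStar_nonneg_of_targetUnmarkedBernsteinStrongIH`.**  Suppose that for every weight `w`, all marks `s b c y` and every vertex
`z ∉ {s,b,c,y}` with `e = s(b,z)` fractional, granted the increasing star for every weight with fewer fractional non-loop pairs and every marking,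
both mixed Bernstein coefficients of `p_e ↦ E₃({s↔b},{s↔c},{s↔y})` are nonnegative.  Then the increasing star holds on every weighted graph on `Fin n`.

Proof (induction on the number of fractional non-loop pairs).  Let `K` be the weight-1 component of the target `b`.  If `K` contains the root or
another target, the star is a covariance or has two equal targets.  If a fractional pair `s(x,v)` leaves a vertex `x ∈ K`, re-target `b ↦ x`
(`{s↔b} = {s↔x}` a.s., `sahiE3_target_eq_of_sureReachable`) and expand along it: the end coefficients are induction hypotheses and the mixed ones
come from `IncStar.rootTarget_polar_nonneg` (`v = s`), `IncStar.targetTarget_polar_nonneg` (`v ∈ {c,y}`) or the hypothesis (`v` unmarked).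
Otherwise `K` is closed, `{s↔b}` is a.s. empty and `E₃ = 0` (`sahiE3_eq_zero_of_target_closed`).  So the TARGET–UNMARKED step is, like hRZ, a
single family of five-point inequalities equivalent in strength to the whole increasing star; neither lies in the light degree-3 cone (memo §3).
-/

noncomputable section

namespace Summit.CriticalPhenomena.PercolationContinuityZ3.Theorems

namespace IncStarIrreducible

open Finset MeasureTheory Literature.Probability.Percolation Literature.Probability.LatticeModels EdgeInduction
open scoped Classical

variable {n : ℕ}

/-- The graph of weight-`1` pairs lies below the open graph of every configuration of the a.s. set. [folklore] -/
private theorem sure_le_open' {w : Sym2 (Fin n) → unitInterval} {ω : BondConfig (Fin n)} (hω : ∀ e, w e = 1 → e ∈ ω) :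
    SimpleGraph.fromEdgeSet {e : Sym2 (Fin n) | w e = 1} ≤ openGraph ω := by
  intro u v huv
  rw [SimpleGraph.fromEdgeSet_adj] at huv
  rw [openGraph_adj]
  exact ⟨hω _ huv.1, huv.2⟩

/-- `{x ↔ z} = {z ↔ x}`. [folklore] -/
private theorem openConn_comm_set (x z : Fin n) : (openConn x z : Set (BondConfig (Fin n))) = openConn z x := by
  ext ω; simp only [openConn, Set.mem_setOf_eq]; exact ⟨SimpleGraph.Reachable.symm, SimpleGraph.Reachable.symm⟩

/-- On the a.s. set, a vertex `x` joined to the target `t` by weight-`1` pairs is reached from `s` iff `t` is. [this work] -/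
theorem openConn_target_inter_eq_of_sureReachable (w : Sym2 (Fin n) → unitInterval) {t x : Fin n}
    (htx : (SimpleGraph.fromEdgeSet {e : Sym2 (Fin n) | w e = 1}).Reachable t x) (s : Fin n) :
    openConn s t ∩ {ω | ∀ e, w e = 1 → e ∈ ω} = openConn s x ∩ {ω | ∀ e, w e = 1 → e ∈ ω} := by
  ext ω
  simp only [Set.mem_inter_iff, openConn, Set.mem_setOf_eq]
  constructor
  · rintro ⟨h, hω⟩; exact ⟨h.trans (htx.mono (sure_le_open' hω)), hω⟩
  · rintro ⟨h, hω⟩; exact ⟨h.trans (htx.mono (sure_le_open' hω)).symm, hω⟩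

/-- **Re-targeting along weight-1 pairs** does not change `E₃` of the hub connections: if `x` is joined to the target `t` by weight-`1`
pairs then `E₃({s↔t},{s↔c},{s↔y}) = E₃({s↔x},{s↔c},{s↔y})`. [this work] -/
theorem sahiE3_target_eq_of_sureReachable (w : Sym2 (Fin n) → unitInterval) {t x : Fin n}
    (htx : (SimpleGraph.fromEdgeSet {e : Sym2 (Fin n) | w e = 1}).Reachable t x) (s c y : Fin n) :
    sahiE3 (prodBernoulli w) (openConn s t) (openConn s c) (openConn s y) =
      sahiE3 (prodBernoulli w) (openConn s x) (openConn s c) (openConn s y) := by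
  have hG := IncStar.real_sureOpen w
  have hm : MeasurableSet {ω : BondConfig (Fin n) | ∀ e, w e = 1 → e ∈ ω} := MeasurableSet.of_discrete
  have key : ∀ S : Set (BondConfig (Fin n)), (prodBernoulli w).real (openConn s t ∩ S) = (prodBernoulli w).real (openConn s x ∩ S) := by
    intro S
    rw [IncStar.real_eq_real_inter_of_real_eq_one hm hG, IncStar.real_eq_real_inter_of_real_eq_one hm hG (openConn s x ∩ S),
      Set.inter_right_comm, openConn_target_inter_eq_of_sureReachable w htx s, ← Set.inter_right_comm]
  have k1 : (prodBernoulli w).real (openConn s t) = (prodBernoulli w).real (openConn s x) := by simpa using key Set.univ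
  simp only [sahiE3_def]
  rw [Set.inter_assoc, key (openConn s c ∩ openConn s y), ← Set.inter_assoc, key (openConn s y), key (openConn s c), k1]

/-- **Closed weight-1 component of a target.**  If every non-loop pair leaving the weight-`1` component `K` of the target `t` has weight `0`
and the root `s` is not in `K`, then `{s↔t}` is a.s. empty and `E₃({s↔t},{s↔c},{s↔y}) = 0`. [this work] -/
theorem sahiE3_eq_zero_of_target_closed (w : Sym2 (Fin n) → unitInterval) (s t c y : Fin n)
    (hcl : ∀ z v : Fin n, (SimpleGraph.fromEdgeSet {e : Sym2 (Fin n) | w e = 1}).Reachable t z →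
      ¬ (SimpleGraph.fromEdgeSet {e : Sym2 (Fin n) | w e = 1}).Reachable t v → z ≠ v → w s(z, v) = 0)
    (hs : ¬ (SimpleGraph.fromEdgeSet {e : Sym2 (Fin n) | w e = 1}).Reachable t s) :
    sahiE3 (prodBernoulli w) (openConn s t) (openConn s c) (openConn s y) = 0 := by
  set G : Set (BondConfig (Fin n)) := {ω | ∀ e, w e = 1 → e ∈ ω} ∩ {ω | ∀ e, w e = 0 → e ∉ ω} with hGdef
  have hG : (prodBernoulli w).real G = 1 := IncStar.real_sureSet w
  have hm : MeasurableSet G := MeasurableSet.of_discrete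
  have hempty : openConn s t ∩ G = ∅ := by
    ext ω
    simp only [Set.mem_inter_iff, Set.mem_empty_iff_false, iff_false, not_and, hGdef, Set.mem_setOf_eq]
    intro h h1 h0
    rw [openConn_comm_set] at h
    exact hs ((IncStar.openConn_iff_sureReachable_of_closed w t hcl h1 h0 s).1 h)
  have hA : (prodBernoulli w).real (openConn s t) = 0 := by
    rw [IncStar.real_eq_real_inter_of_real_eq_one hm hG, hempty, measureReal_empty]
  have hz : ∀ S : Set (BondConfig (Fin n)), (prodBernoulli w).real (openConn s t ∩ S) = 0 := fun S =>
    le_antisymm (hA ▸ measureReal_mono Set.inter_subset_left) measureReal_nonneg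
  rw [sahiE3_def, Set.inter_assoc, hz, hz, hz, hA]
  ring

/-- No fractional non-loop pair leaves the weight-`1` component of the target `b`: then the star holds outright (the component contains the
root — a covariance — or is closed — `E₃ = 0`). [this work] -/
theorem incStar_of_noFrac_at_targetComponent (w : Sym2 (Fin n) → unitInterval) (s b c y : Fin n)
    (hnf : ∀ x v : Fin n, (SimpleGraph.fromEdgeSet {e : Sym2 (Fin n) | w e = 1}).Reachable b x → x ≠ v → s(x, v) ∉ fracEdges w) :
    0 ≤ sahiE3 (prodBernoulli w) (openConn s b) (openConn s c) (openConn s y) := by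
  by_cases hs : (SimpleGraph.fromEdgeSet {e : Sym2 (Fin n) | w e = 1}).Reachable b s
  · rw [sahiE3_target_eq_of_sureReachable w hs s c y]
    exact incStar_root_target w s c y
  · refine le_of_eq (sahiE3_eq_zero_of_target_closed w s b c y ?_ hs).symm
    intro z v hz hv hzv
    rcases eq_zero_or_one_of_not_mem_fracEdges (hnf z v hz hzv) with h0 | h1
    · exact h0
    · exact absurd (hz.trans (SimpleGraph.Adj.reachable (by
        rw [SimpleGraph.fromEdgeSet_adj]; exact ⟨h1, hzv⟩))) hv

/-- **TARGET-EDGE INDUCTION SCHEMA for the increasing star (strong induction hypothesis).**  If both mixed Bernstein coefficients of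
`p_e ↦ E₃({s↔b},{s↔c},{s↔y})` along every fractional TARGET–UNMARKED pair `e = s(b,z)` (`z ∉ {s,b,c,y}`) are nonnegative — granted the increasing
star for every weight with fewer fractional non-loop pairs and every marking — then the increasing star holds on every weighted graph on `Fin n`.
The root–target and target–target pairs are discharged by the exact certificates `IncStar.rootTarget_polar_nonneg` (gen 4) and
`IncStar.targetTarget_polar_nonneg` (gen 13). [this work] -/
theorem incStar_nonneg_of_targetUnmarkedBernsteinStrongIH
    (h : ∀ (w : Sym2 (Fin n) → unitInterval) (s b c y z : Fin n), z ≠ s → z ≠ b → z ≠ c → z ≠ y → s(b, z) ∈ fracEdges w →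
      (∀ w' : Sym2 (Fin n) → unitInterval,
          ((fracEdges w').filter fun e => ¬ e.IsDiag).card < ((fracEdges w).filter fun e => ¬ e.IsDiag).card →
          ∀ s' b' c' y' : Fin n, 0 ≤ sahiE3 (prodBernoulli w') (openConn s' b') (openConn s' c') (openConn s' y')) →
      0 ≤ polar₁ (prodBernoulli (Function.update w s(b, z) 0)) (prodBernoulli (Function.update w s(b, z) 1))
            (openConn s b) (openConn s c) (openConn s y) ∧
        0 ≤ polar₁ (prodBernoulli (Function.update w s(b, z) 1)) (prodBernoulli (Function.update w s(b, z) 0))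
            (openConn s b) (openConn s c) (openConn s y)) :
    ∀ (w : Sym2 (Fin n) → unitInterval) (s b c y : Fin n),
      0 ≤ sahiE3 (prodBernoulli w) (openConn s b) (openConn s c) (openConn s y) := by
  -- induction on the number of fractional NON-LOOP pairs
  suffices H : ∀ (k : ℕ) (w : Sym2 (Fin n) → unitInterval), ((fracEdges w).filter fun e => ¬ e.IsDiag).card ≤ k →
      ∀ s b c y : Fin n, 0 ≤ sahiE3 (prodBernoulli w) (openConn s b) (openConn s c) (openConn s y) from
    fun w s b c y => H _ w le_rfl s b c y
  intro k
  induction k with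
  | zero =>
      intro w hk s b c y
      refine incStar_of_noFrac_at_targetComponent w s b c y fun x v _ hxv hmem => ?_
      have : s(x, v) ∈ (fracEdges w).filter fun e => ¬ e.IsDiag := by
        rw [Finset.mem_filter]; exact ⟨hmem, by rwa [Sym2.mk_isDiag_iff]⟩
      have := Finset.card_pos.2 ⟨_, this⟩
      omega
  | succ k ih =>
      intro w hk s b c y
      set G1 := SimpleGraph.fromEdgeSet {e : Sym2 (Fin n) | w e = 1} with hG1
      by_cases hfr : ∃ x v : Fin n, G1.Reachable b x ∧ x ≠ v ∧ s(x, v) ∈ fracEdges w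
      swap
      · push Not at hfr
        exact incStar_of_noFrac_at_targetComponent w s b c y fun x v hbx hxv => hfr x v hbx hxv
      obtain ⟨x, v, hbx, hxv, he⟩ := hfr
      -- degenerate re-targetings: the weight-1 component of `b` contains the root or another target
      by_cases hRs : G1.Reachable b s
      · rw [sahiE3_target_eq_of_sureReachable w hRs s c y]; exact incStar_root_target w s c y
      by_cases hRc : G1.Reachable b c
      · rw [sahiE3_target_eq_of_sureReachable w hRc s c y]; exact incStar_targets_eq w s c y
      by_cases hRy : G1.Reachable b y
      · rw [sahiE3_target_eq_of_sureReachable w hRy s c y, sahiE3_comm₂₃]; exact incStar_targets_eq w s y c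
      have hxs : x ≠ s := fun hh => hRs (hh ▸ hbx)
      have hxc : x ≠ c := fun hh => hRc (hh ▸ hbx)
      have hxy : x ≠ y := fun hh => hRy (hh ▸ hbx)
      -- re-target `b ↦ x` and expand along the fractional pair `e = s(x,v)`
      rw [sahiE3_target_eq_of_sureReachable w hbx s c y]
      have hcard : ∀ (e : Sym2 (Fin n)), e ∈ fracEdges w → ¬ e.IsDiag → ∀ (u : unitInterval), u = 0 ∨ u = 1 →
          ((fracEdges (Function.update w e u)).filter fun f => ¬ f.IsDiag).card ≤ k := by
        intro e he' hnd u hu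
        have hmemf : e ∈ (fracEdges w).filter fun f => ¬ f.IsDiag := Finset.mem_filter.2 ⟨he', hnd⟩
        have hsub : ((fracEdges (Function.update w e u)).filter fun f => ¬ f.IsDiag) ⊆
            ((fracEdges w).filter fun f => ¬ f.IsDiag).erase e := by
          intro f hf
          rw [Finset.mem_filter] at hf
          have hf' := fracEdges_update_subset w e u hu hf.1
          rw [Finset.mem_erase] at hf' ⊢
          exact ⟨hf'.1, Finset.mem_filter.2 ⟨hf'.2, hf.2⟩⟩
        have h1 := Finset.card_le_card hsub
        rw [Finset.card_erase_of_mem hmemf] at h1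
        omega
      -- the strong induction hypothesis package for the TZ hypothesis
      have IHpack : ∀ w' : Sym2 (Fin n) → unitInterval,
          ((fracEdges w').filter fun e => ¬ e.IsDiag).card < ((fracEdges w).filter fun e => ¬ e.IsDiag).card →
          ∀ s' b' c' y' : Fin n, 0 ≤ sahiE3 (prodBernoulli w') (openConn s' b') (openConn s' c') (openConn s' y') :=
        fun w' hw' s' b' c' y' => ih w' (by omega) s' b' c' y'
      by_cases hvs : v = s
      · -- root–target pair `s(s,x)`
        subst hvs
        have hee : s(x, v) = s(v, x) := Sym2.eq_swap
        rw [hee] at he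
        have hnd : ¬ (s(v, x)).IsDiag := by rw [Sym2.mk_isDiag_iff]; exact hxs.symm
        have i0 := ih _ (hcard _ he hnd 0 (Or.inl rfl)) v x c y
        have i1 := ih _ (hcard _ he hnd 1 (Or.inr rfl)) v x c y
        obtain ⟨b1, b2⟩ := IncStar.rootTarget_polar_nonneg w v x c y hxs.symm i0
        exact sahiE3_nonneg_of_bernsteinCoeffs w s(v, x) _ _ _ i0 b1 b2 i1
      by_cases hvc : v = c
      · -- target–target pair `s(x,c)`
        subst hvc
        have hnd : ¬ (s(x, v)).IsDiag := by rw [Sym2.mk_isDiag_iff]; exact hxv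
        have i0 := ih _ (hcard _ he hnd 0 (Or.inl rfl)) s x v y
        have i1 := ih _ (hcard _ he hnd 1 (Or.inr rfl)) s x v y
        obtain ⟨b1, b2⟩ := IncStar.targetTarget_polar_nonneg w s x v y i0
        exact sahiE3_nonneg_of_bernsteinCoeffs w s(x, v) _ _ _ i0 b1 b2 i1
      by_cases hvy : v = y
      · -- target–target pair `s(x,y)`: swap the last two events
        subst hvy
        have hnd : ¬ (s(x, v)).IsDiag := by rw [Sym2.mk_isDiag_iff]; exact hxv
        rw [sahiE3_comm₂₃]
        have i0 := ih _ (hcard _ he hnd 0 (Or.inl rfl)) s x v c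
        have i1 := ih _ (hcard _ he hnd 1 (Or.inr rfl)) s x v c
        obtain ⟨b1, b2⟩ := IncStar.targetTarget_polar_nonneg w s x v c i0
        exact sahiE3_nonneg_of_bernsteinCoeffs w s(x, v) _ _ _ i0 b1 b2 i1
      -- target–unmarked pair: the hypothesis
      have hnd : ¬ (s(x, v)).IsDiag := by rw [Sym2.mk_isDiag_iff]; exact hxv
      have i0 := ih _ (hcard _ he hnd 0 (Or.inl rfl)) s x c y
      have i1 := ih _ (hcard _ he hnd 1 (Or.inr rfl)) s x c y
      obtain ⟨b1, b2⟩ := h w s x c y v hvs (Ne.symm hxv) hvc hvy he IHpack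
      exact sahiE3_nonneg_of_bernsteinCoeffs w s(x, v) _ _ _ i0 b1 b2 i1

end IncStarIrreducible

end Summit.CriticalPhenomena.PercolationContinuityZ3.Theorems
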